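import Summits.QuantumFields.BalabanUV.Beta.FP.TowerDoorDefectPieces
import Summits.QuantumFields.BalabanUV.Beta.TameKernelCalculus

/-!
# `BalabanUV.Beta.FP.TowerDoorDefectPairing` — binder row D1, the row's ONE file, the `ω`-EXHIBITION, part 2 (J-NOTE-21 §7 (B)): **THE DOOR FUNCTIONAL IS AN `ℓ¹` PAIRING —
# `tadpole A (defKerZ L tabs κ₂ v β) = Σ'_u tadpole A (defKerZ L tabs κ₂ (Pi.single u 1) β) · v u` FOR EVERY BOUNDED GAUGE FUNCTION `v`, with `u ↦ tadpole A (defKerZ … (Pi.single u 1) β)` ABSOLUTELY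
# SUMMABLE** (definition-free: the weight is the functional's value on the lattice delta functions) — so p670056 §5's `τd j κ y := κτ • l1Pairing (that weight at β = (y, κ))` (PART 61) IS
# `v ↦ κτ·tadpole (AN) (DefKerℤ v (y,κ))` on `V j := lp ⊤`, linear for free, and `hΘ` (PART 61), `hX` (PART 65) meet in the same letter
# (β-function cell `pub-balaban`, BINDER-OWNERS row D1 ∕ (C1) OWNER «beta-an2» gen 77, PART 67; imports PART 66 + the row's `TameKernelCalculus`)

WHAT ([folklore] `tsum` re-indexing + `Loc`∕`tadpole_add` bookkeeping BY NAME; no `def`, no `def … : Prop`, nothing cited, 0 sorry, default heartbeats).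
§1 `defKerZ_eq_pieces` (PART 62's `defKerZ` AS A KERNEL: `Σ_κ G_κ − κ₂ • (R − C)`, the pieces PART 66's lambdas), the pieces are `Loc` for bounded `v` (`loc_gradPiece`, `loc_rowPiece`, `loc_colPiece` — PART 64∕66's
bi-localisations), **`tadpole_defKerZ_pieces`** (`tadpole A (defKerZ … v β) = Σ_κ Σ'_u (v(u+e_κ) − v u)·t₁ κ u − κ₂·(Σ'_u v u·t₂ u − Σ'_u v u·t₃ u)` — the row's `TameKernelCalculus.tadpole_add`∕`Loc.*` + lit
`tadpole_smul` + PART 66).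
§2 the weights decay: `abs_t1_le` ∕ `abs_t2_le` ∕ `abs_t3_le` (`≤ const·e^{−(δ/2)|u − L•β.1|₁}`, lit `abs_tadpole_le`), hence `summable_*`; `tsum_shiftDiff_mul` (`Σ'_u (v(u+e) − v u)·t u = Σ'_u v u·(t (u−e) − t u)` for
bounded `v` and `ℓ¹` `t`).
§3 **`tadpole_defKerZ_eq_tsum_weight`** (`tadpole A (defKerZ … v β) = Σ'_u ω_β(u)·v u`, `ω_β(u) := Σ_κ (t₁ κ (u − e_κ) − t₁ κ u) − κ₂·(t₂ u − t₃ u)` spelled out), **`tadpole_defKerZ_single`** (`ω_β(u) =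
tadpole A (defKerZ … (Pi.single u 1) β)`), **`summable_abs_tadpole_defKerZ_single`**, **`tadpole_defKerZ_eq_tsum_single`** — the headline identity.
WHAT THIS IS NOT: not the covariance `ω_{(y,κ)} = ω_{(0,κ)}(· − L•y)` (next: `tabs.hmixt`∕`hHt` + `shiftK`-invariance of `A` + lit `tadpole_shiftK`), not the record instance, not (T2); nothing of Bałaban's asserted,
valued or discharged; 0 estimates; 0∕4 row-D1 binders (hW, hR, D1Tel, D1Rep); NOT (C1), NOT D1, NEVER «G-an2-4 closed», NOT BetaPertH, NOT continuum, NOT Clay.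

HONEST DEPENDENCY (page 1, mandatory): continuum YM on T⁴ ⇐ BetaPertH ∧ nine spine estimates (0/9 proved); BetaPertH ⇐ (D1) ∧ (D4) ∧ CAP+tail;
G-an2-4 gates asym, D1 and NE2/3/4.  HONEST FRAMING (cell contract, verbatim): «discharging `BetaPertH` makes Bałaban's UV stability UNCONDITIONAL —
a real constructive-QFT result; it is NOT the continuum limit and NOT the Clay problem.»  ABSOLUTE RULE (cell charter, verbatim): «No internally-minted
statement may enter as a cited fact. Every hypothesis is either kernel-proved in this package or a verbatim quotation of a PUBLISHED theorem with page
reference. The manuscript(s) under audit are NOT citable for their own disputed steps — they are the thing under adjudication; programme-internal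
(2001/route/tribunal) claims are never citable.»  Row D1 ∕ (C1) OWNER «beta-an2» gen 77, 2026-08-29.  No existing file touched.
-/

noncomputable section

open Finset
open scoped BigOperators
open Literature.MathematicalPhysics.QuantumFieldTheory
open Literature.MathematicalPhysics.QuantumFieldTheory.Balaban1983to89
open Literature.MathematicalPhysics.QuantumFieldTheory.Balaban1983to89.Beta
open Literature.MathematicalPhysics.QuantumFieldTheory.Balaban1983to89.B12Sec2to5 (l1 l1_nonneg)
open AffineAveraging (Site unitVec)
open OneStepResolventKernel (Fib)
open ExpKernelCalculus (MKer BiLoc Decays VertexFamily Zl Zl_nonneg tadpole abs_tadpole_le summable_exp_shift summable_exp_shift')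
open SecondOrderResponse (LocStencilFM)
open KernelReflection (tadpole_smul)
open BalabanStepW2 (wM2)
open Summit.QuantumFields.BalabanUV.Beta.SymmetrisedStepJets (SymTables)
open Summit.QuantumFields.BalabanUV.Beta.TameKernelCalculus (Spr Loc tadpole_add)
open Summit.QuantumFields.BalabanUV.Beta.FP.RepAlgebraTrace (abs_le_of_biLoc)
open Summit.QuantumFields.BalabanUV.Beta.FP.RepAlgebraBubble (biLoc_of_rate_le)
open Summit.QuantumFields.BalabanUV.Beta.FP.TowerDoorDefectDefs
open Summit.QuantumFields.BalabanUV.Beta.FP.TowerDoorDefectLoc (biLoc_M2Z biLoc_gradTerm)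
open Summit.QuantumFields.BalabanUV.Beta.FP.TowerDoorDefectPieces

namespace Summit.QuantumFields.BalabanUV.Beta.FP.TowerDoorDefectPairing

variable (L : ℕ) (tabs : SymTables 3 L) (κ₂ : ℝ)

/-! ## §1 The defect kernel as a kernel combination of its pieces; the tadpole splits -/

/-- [folklore] **`defKerZ_eq_pieces`** — AS A KERNEL: `defKerZ … v β = (Σ_κ G_κ) − κ₂ • (R − C)` with PART 66's pieces (gradient pieces `G_κ`, row piece `R`, column piece `C`). -/
theorem defKerZ_eq_pieces (v : Site (3 + 1) → ℝ) (β : Site (3 + 1) × Fin (3 + 1)) :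
    defKerZ L tabs κ₂ v β
      = (∑ κ : Fin (3 + 1), fun (x w : Site (3 + 1)) (a b : Fib 3) => ∑' u : Site (3 + 1), (v (u + unitVec κ) - v u)
            * Sum.elim (fun α : Fin (3 + 1) => Sum.elim (fun α' : Fin (3 + 1) => M2Z L tabs (u, κ) β x w (Sum.inl α) (Sum.inl α')) (fun _ => (0 : ℝ)) b) (fun _ => (0 : ℝ)) a)
        - κ₂ • ((fun (x w : Site (3 + 1)) (a b : Fib 3) => v x
              * Sum.elim (fun α : Fin (3 + 1) => Sum.elim (fun α' : Fin (3 + 1) => tabs.H β.2 β.1 x w (Sum.inl α) (Sum.inl α')) (fun _ => (0 : ℝ)) b) (fun _ => (0 : ℝ)) a)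
            - (fun (x w : Site (3 + 1)) (a b : Fib 3) =>
              Sum.elim (fun α : Fin (3 + 1) => Sum.elim (fun α' : Fin (3 + 1) => tabs.H β.2 β.1 x w (Sum.inl α) (Sum.inl α')) (fun _ => (0 : ℝ)) b) (fun _ => (0 : ℝ)) a * v w)) := by
  funext x w a b
  rw [defKerZ_apply_pieces]
  simp only [Pi.sub_apply, Pi.smul_apply, Finset.sum_apply, smul_eq_mul]

variable {A : MKer (3 + 1) (Fib 3)} {CA C δ C_H : ℝ}

/-- [folklore] the gradient piece of a bounded gauge function is `Loc` (PART 64 `biLoc_gradTerm`, masked). -/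
theorem loc_gradPiece (hδ : 0 < δ) (hmix : LocStencilFM L tabs.mixFF C δ) {v : Site (3 + 1) → ℝ} {V : ℝ} (hV : 0 ≤ V) (hv : ∀ u, |v u| ≤ V)
    (κ : Fin (3 + 1)) (β : Site (3 + 1) × Fin (3 + 1)) :
    Loc (fun (x w : Site (3 + 1)) (a b : Fib 3) => ∑' u : Site (3 + 1), (v (u + unitVec κ) - v u)
      * Sum.elim (fun α : Fin (3 + 1) => Sum.elim (fun α' : Fin (3 + 1) => M2Z L tabs (u, κ) β x w (Sum.inl α) (Sum.inl α')) (fun _ => (0 : ℝ)) b) (fun _ => (0 : ℝ)) a) := by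
  have h := biLoc_gradTerm L tabs hmix hδ hV hv κ β
  have hC : 0 ≤ C := hmix.nonneg
  have hZ : 0 ≤ Zl (3 + 1) (δ / 2) := Zl_nonneg (half_pos hδ)
  refine ⟨((L : ℕ) : ℤ) • β.1, ((L : ℕ) : ℤ) • β.1, 2 * V * (|wM2 3 L 0| * C) * Zl (3 + 1) (δ / 2), δ / 2, half_pos hδ, fun x w a b => ?_⟩
  rcases a with α | m
  · rcases b with α' | m'
    · show |∑' u : Site (3 + 1), (v (u + unitVec κ) - v u) * M2Z L tabs (u, κ) β x w (Sum.inl α) (Sum.inl α')| ≤ _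
      exact h x w (Sum.inl α) (Sum.inl α')
    · show |∑' u : Site (3 + 1), (v (u + unitVec κ) - v u) * (0 : ℝ)| ≤ _
      simp only [mul_zero, tsum_zero, abs_zero]
      positivity
  · show |∑' u : Site (3 + 1), (v (u + unitVec κ) - v u) * (0 : ℝ)| ≤ _
    simp only [mul_zero, tsum_zero, abs_zero]
    positivity

/-- [folklore] the row piece of a bounded gauge function is `Loc` ((LH)). -/
theorem loc_rowPiece (hδ : 0 < δ) (hH : VertexFamily tabs.H L C_H δ) {v : Site (3 + 1) → ℝ} {V : ℝ} (hV : 0 ≤ V) (hv : ∀ u, |v u| ≤ V)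
    (β : Site (3 + 1) × Fin (3 + 1)) :
    Loc (fun (x w : Site (3 + 1)) (a b : Fib 3) => v x
      * Sum.elim (fun α : Fin (3 + 1) => Sum.elim (fun α' : Fin (3 + 1) => tabs.H β.2 β.1 x w (Sum.inl α) (Sum.inl α')) (fun _ => (0 : ℝ)) b) (fun _ => (0 : ℝ)) a) := by
  have hm := biLoc_ffMask (hH β.2 β.1)
  have hCH : 0 ≤ C_H := (hH β.2 β.1).nonneg (Sum.inl 0)
  refine ⟨((L : ℕ) : ℤ) • β.1, ((L : ℕ) : ℤ) • β.1, V * C_H, δ, hδ, fun x w a b => ?_⟩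
  rw [abs_mul, mul_assoc]
  exact mul_le_mul (hv x) (hm x w a b) (abs_nonneg _) hV

/-- [folklore] the column piece of a bounded gauge function is `Loc` ((LH)). -/
theorem loc_colPiece (hδ : 0 < δ) (hH : VertexFamily tabs.H L C_H δ) {v : Site (3 + 1) → ℝ} {V : ℝ} (hv : ∀ u, |v u| ≤ V)
    (β : Site (3 + 1) × Fin (3 + 1)) :
    Loc (fun (x w : Site (3 + 1)) (a b : Fib 3) =>
      Sum.elim (fun α : Fin (3 + 1) => Sum.elim (fun α' : Fin (3 + 1) => tabs.H β.2 β.1 x w (Sum.inl α) (Sum.inl α')) (fun _ => (0 : ℝ)) b) (fun _ => (0 : ℝ)) a * v w) := by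
  have hm := biLoc_ffMask (hH β.2 β.1)
  have hCH : 0 ≤ C_H := (hH β.2 β.1).nonneg (Sum.inl 0)
  refine ⟨((L : ℕ) : ℤ) • β.1, ((L : ℕ) : ℤ) • β.1, C_H * V, δ, hδ, fun x w a b => ?_⟩
  rw [abs_mul]
  calc _ ≤ (C_H * Real.exp (-δ * (l1 (x - ((L : ℕ) : ℤ) • β.1) + l1 (w - ((L : ℕ) : ℤ) • β.1)))) * V :=
        mul_le_mul (hm x w a b) (hv w) (abs_nonneg _) (by positivity)
    _ = _ := by ring

/-- [folklore] **`tadpole_defKerZ_pieces` — THE TADPOLE OF THE DEFECT KERNEL SPLITS INTO ITS PIECES** (row's `tadpole_add` on `Loc` pieces, lit `tadpole_smul`, PART 66 per piece):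
`tadpole A (defKerZ … v β) = Σ_κ Σ'_u (v(u+e_κ) − v u)·t₁ κ u − κ₂·(Σ'_u v u·t₂ u − Σ'_u v u·t₃ u)`. -/
theorem tadpole_defKerZ_pieces (hδ : 0 < δ) (hA : Decays A CA (δ / 2)) (hmix : LocStencilFM L tabs.mixFF C δ) (hH : VertexFamily tabs.H L C_H δ)
    {v : Site (3 + 1) → ℝ} {V : ℝ} (hV : 0 ≤ V) (hv : ∀ u, |v u| ≤ V) (β : Site (3 + 1) × Fin (3 + 1)) :
    tadpole A (defKerZ L tabs κ₂ v β)
      = (∑ κ : Fin (3 + 1), ∑' u : Site (3 + 1), (v (u + unitVec κ) - v u)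
          * tadpole A (fun (x w : Site (3 + 1)) (a b : Fib 3) =>
              Sum.elim (fun α : Fin (3 + 1) => Sum.elim (fun α' : Fin (3 + 1) => M2Z L tabs (u, κ) β x w (Sum.inl α) (Sum.inl α')) (fun _ => (0 : ℝ)) b) (fun _ => (0 : ℝ)) a))
        - κ₂ * ((∑' u : Site (3 + 1), v u * tadpole A (fun (x w : Site (3 + 1)) (a b : Fib 3) => if u = x then
              Sum.elim (fun α : Fin (3 + 1) => Sum.elim (fun α' : Fin (3 + 1) => tabs.H β.2 β.1 x w (Sum.inl α) (Sum.inl α')) (fun _ => (0 : ℝ)) b) (fun _ => (0 : ℝ)) a else 0))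
          - (∑' u : Site (3 + 1), v u * tadpole A (fun (x w : Site (3 + 1)) (a b : Fib 3) => if u = w then
              Sum.elim (fun α : Fin (3 + 1) => Sum.elim (fun α' : Fin (3 + 1) => tabs.H β.2 β.1 x w (Sum.inl α) (Sum.inl α')) (fun _ => (0 : ℝ)) b) (fun _ => (0 : ℝ)) a else 0))) := by
  have hSpr : Spr A := ⟨CA, δ / 2, half_pos hδ, hA⟩
  -- names for the pieces
  set G : Fin (3 + 1) → MKer (3 + 1) (Fib 3) := fun κ => fun (x w : Site (3 + 1)) (a b : Fib 3) => ∑' u : Site (3 + 1), (v (u + unitVec κ) - v u)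
      * Sum.elim (fun α : Fin (3 + 1) => Sum.elim (fun α' : Fin (3 + 1) => M2Z L tabs (u, κ) β x w (Sum.inl α) (Sum.inl α')) (fun _ => (0 : ℝ)) b) (fun _ => (0 : ℝ)) a with hG
  set R : MKer (3 + 1) (Fib 3) := fun (x w : Site (3 + 1)) (a b : Fib 3) => v x
      * Sum.elim (fun α : Fin (3 + 1) => Sum.elim (fun α' : Fin (3 + 1) => tabs.H β.2 β.1 x w (Sum.inl α) (Sum.inl α')) (fun _ => (0 : ℝ)) b) (fun _ => (0 : ℝ)) a with hR
  set Cc : MKer (3 + 1) (Fib 3) := fun (x w : Site (3 + 1)) (a b : Fib 3) =>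
      Sum.elim (fun α : Fin (3 + 1) => Sum.elim (fun α' : Fin (3 + 1) => tabs.H β.2 β.1 x w (Sum.inl α) (Sum.inl α')) (fun _ => (0 : ℝ)) b) (fun _ => (0 : ℝ)) a * v w with hCc
  have hGloc : ∀ κ, Loc (G κ) := fun κ => loc_gradPiece L tabs hδ hmix hV hv κ β
  have hRloc : Loc R := loc_rowPiece L tabs hδ hH hV hv β
  have hCloc : Loc Cc := loc_colPiece L tabs hδ hH hv β
  have hsumloc : ∀ s : Finset (Fin (3 + 1)), Loc (∑ κ ∈ s, G κ) := by
    intro s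
    induction s using Finset.induction_on with
    | empty =>
      rw [Finset.sum_empty]
      refine ⟨0, 0, 0, 1, one_pos, fun x w a b => ?_⟩
      simp
    | insert κ s hκ ih => rw [Finset.sum_insert hκ]; exact (hGloc κ).add ih
  have htadsum : ∀ s : Finset (Fin (3 + 1)), tadpole A (∑ κ ∈ s, G κ) = ∑ κ ∈ s, tadpole A (G κ) := by
    intro s
    induction s using Finset.induction_on with
    | empty =>
      rw [Finset.sum_empty, Finset.sum_empty]
      simp [tadpole, ExpKernelCalculus.tr, ExpKernelCalculus.comp]
    | insert κ s hκ ih => rw [Finset.sum_insert hκ, Finset.sum_insert hκ, tadpole_add hSpr (hGloc κ) (hsumloc s), ih]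
  rw [defKerZ_eq_pieces]
  show tadpole A ((∑ κ : Fin (3 + 1), G κ) - κ₂ • (R - Cc)) = _
  rw [sub_eq_add_neg, ← neg_smul, tadpole_add hSpr (hsumloc _) ((hRloc.sub hCloc).smul _), tadpole_smul, htadsum,
    sub_eq_add_neg R, tadpole_add hSpr hRloc hCloc.neg, show -Cc = (-1 : ℝ) • Cc by simp, tadpole_smul]
  rw [tadpole_rowPiece L tabs hδ hA hH hv β, tadpole_colPiece L tabs hδ hA hH hv β]
  have eG : ∀ κ, tadpole A (G κ) = ∑' u : Site (3 + 1), (v (u + unitVec κ) - v u)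
      * tadpole A (fun (x w : Site (3 + 1)) (a b : Fib 3) =>
          Sum.elim (fun α : Fin (3 + 1) => Sum.elim (fun α' : Fin (3 + 1) => M2Z L tabs (u, κ) β x w (Sum.inl α) (Sum.inl α')) (fun _ => (0 : ℝ)) b) (fun _ => (0 : ℝ)) a) :=
    fun κ => tadpole_gradPiece L tabs hδ hA hmix hv κ β
  simp_rw [eG]
  ring


/-! ## §2 The weights decay; the gradient pairing re-indexed onto the gauge function -/

/-- [folklore] **the gradient weights decay from the window**: `∃ B ≥ 0, ∀ κ u, |tadpole A ([M2Z (u,κ) β]_ff)| ≤ B·e^{−δ|u − L•β.1|₁}` (lit `abs_tadpole_le` at `p = q = u` with PART 64's constant). -/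
theorem exists_abs_tadpole_gradStencil_le (hδ : 0 < δ) (hA : Decays A CA (δ / 2)) (hmix : LocStencilFM L tabs.mixFF C δ) (β : Site (3 + 1) × Fin (3 + 1)) :
    ∃ B : ℝ, 0 ≤ B ∧ ∀ (κ : Fin (3 + 1)) (u : Site (3 + 1)),
      |tadpole A (fun (x w : Site (3 + 1)) (a b : Fib 3) =>
          Sum.elim (fun α : Fin (3 + 1) => Sum.elim (fun α' : Fin (3 + 1) => M2Z L tabs (u, κ) β x w (Sum.inl α) (Sum.inl α')) (fun _ => (0 : ℝ)) b) (fun _ => (0 : ℝ)) a)|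
        ≤ B * Real.exp (-δ * l1 (u - ((L : ℕ) : ℤ) • β.1)) := by
  have hδ2 : 0 < δ / 2 := half_pos hδ
  have hC : 0 ≤ C := hmix.nonneg
  have hCA : 0 ≤ CA := hA.nonneg (Sum.inl 0)
  refine ⟨(Fintype.card (Fib 3) : ℝ) * ((Fintype.card (Fib 3) : ℝ) * (CA * (|wM2 3 L 0| * C)) * Zl (3 + 1) (δ / 2 - δ / 2 / 2)) * Zl (3 + 1) (δ / 2 / 2 / 2),
    by have := Zl_nonneg (D := 3 + 1) (show 0 < δ / 2 - δ / 2 / 2 by linarith); have := Zl_nonneg (D := 3 + 1) (show 0 < δ / 2 / 2 / 2 by positivity); positivity,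
    fun κ u => ?_⟩
  have hM : BiLoc (fun (x w : Site (3 + 1)) (a b : Fib 3) =>
      Sum.elim (fun α : Fin (3 + 1) => Sum.elim (fun α' : Fin (3 + 1) => M2Z L tabs (u, κ) β x w (Sum.inl α) (Sum.inl α')) (fun _ => (0 : ℝ)) b) (fun _ => (0 : ℝ)) a)
      u u (|wM2 3 L 0| * (C * Real.exp (-δ * l1 (u - ((L : ℕ) : ℤ) • β.1)))) (δ / 2) :=
    biLoc_of_rate_le (biLoc_ffMask (biLoc_M2Z L tabs hmix u κ β)) (by linarith)
  have h := abs_tadpole_le hA hM hδ2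
  rw [sub_self, show l1 (0 : Site (3 + 1)) = 0 by simp [l1], mul_zero, Real.exp_zero, mul_one] at h
  refine h.trans (le_of_eq ?_)
  ring

/-- [folklore] **the row-cut and column-cut weights decay from the window**: `∃ B ≥ 0, ∀ u, |tadpole A (row-cut u)| ≤ B·e^{−(δ/2)|u − L•β.1|₁}` and the same for the column-cut (PART 66's constants). -/
theorem exists_abs_tadpole_cuts_le (hδ : 0 < δ) (hA : Decays A CA (δ / 2)) (hH : VertexFamily tabs.H L C_H δ) (β : Site (3 + 1) × Fin (3 + 1)) :
    ∃ B : ℝ, 0 ≤ B ∧ ∀ u : Site (3 + 1),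
      |tadpole A (fun (x w : Site (3 + 1)) (a b : Fib 3) => if u = x then
          Sum.elim (fun α : Fin (3 + 1) => Sum.elim (fun α' : Fin (3 + 1) => tabs.H β.2 β.1 x w (Sum.inl α) (Sum.inl α')) (fun _ => (0 : ℝ)) b) (fun _ => (0 : ℝ)) a else 0)|
        ≤ B * Real.exp (-(δ / 2) * l1 (u - ((L : ℕ) : ℤ) • β.1)) ∧
      |tadpole A (fun (x w : Site (3 + 1)) (a b : Fib 3) => if u = w then
          Sum.elim (fun α : Fin (3 + 1) => Sum.elim (fun α' : Fin (3 + 1) => tabs.H β.2 β.1 x w (Sum.inl α) (Sum.inl α')) (fun _ => (0 : ℝ)) b) (fun _ => (0 : ℝ)) a else 0)|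
        ≤ B * Real.exp (-(δ / 2) * l1 (u - ((L : ℕ) : ℤ) • β.1)) := by
  have hδ2 : 0 < δ / 2 := half_pos hδ
  have hCH : 0 ≤ C_H := (hH β.2 β.1).nonneg (Sum.inl 0)
  have hCA : 0 ≤ CA := hA.nonneg (Sum.inl 0)
  refine ⟨(Fintype.card (Fib 3) : ℝ) * ((Fintype.card (Fib 3) : ℝ) * (CA * C_H) * Zl (3 + 1) (δ / 2 - δ / 2 / 2)) * Zl (3 + 1) (δ / 2 / 2 / 2),
    by have := Zl_nonneg (D := 3 + 1) (show 0 < δ / 2 - δ / 2 / 2 by linarith); have := Zl_nonneg (D := 3 + 1) (show 0 < δ / 2 / 2 / 2 by positivity); positivity,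
    fun u => ⟨?_, ?_⟩⟩
  · have h := abs_tadpole_le hA (biLoc_rowCut L tabs hδ.le hH β u) hδ2
    rw [sub_self, show l1 (0 : Site (3 + 1)) = 0 by simp [l1], mul_zero, Real.exp_zero, mul_one] at h
    refine h.trans (le_of_eq ?_)
    ring
  · have h := abs_tadpole_le hA (biLoc_colCut L tabs hδ.le hH β u) hδ2
    rw [sub_self, show l1 (0 : Site (3 + 1)) = 0 by simp [l1], mul_zero, Real.exp_zero, mul_one] at h
    refine h.trans (le_of_eq ?_)
    ring

/-- [folklore] an exponentially decaying family against a bounded one is absolutely summable (the generic step used four times below). -/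
theorem summable_abs_mul_of_decay {t v : Site (3 + 1) → ℝ} {B V ρ : ℝ} {p : Site (3 + 1)} (hρ : 0 < ρ)
    (ht : ∀ u, |t u| ≤ B * Real.exp (-ρ * l1 (u - p))) (hv : ∀ u, |v u| ≤ V) :
    Summable (fun u => |v u * t u|) := by
  have hB : 0 ≤ B := by
    have h := ht p
    rw [sub_self, show l1 (0 : Site (3 + 1)) = 0 by simp [l1], mul_zero, Real.exp_zero, mul_one] at h
    exact (abs_nonneg _).trans h
  have hV : 0 ≤ V := (abs_nonneg _).trans (hv p)
  refine Summable.of_nonneg_of_le (fun u => abs_nonneg _) (fun u => ?_) ((summable_exp_shift' hρ p).mul_left (V * B))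
  rw [abs_mul]
  calc |v u| * |t u| ≤ V * (B * Real.exp (-ρ * l1 (u - p))) := mul_le_mul (hv u) (ht u) (abs_nonneg _) hV
    _ = V * B * Real.exp (-ρ * l1 (u - p)) := by ring

/-- [folklore] **`tsum_shiftDiff_mul`** — summation by parts on the lattice: `Σ'_u (v(u+e) − v u)·t u = Σ'_u v u·(t (u−e) − t u)` for an absolutely summable `v·t`-type pairing
(both pieces summable; `Equiv.addRight` re-indexing). -/
theorem tsum_shiftDiff_mul {t v : Site (3 + 1) → ℝ} (e : Site (3 + 1)) (h1 : Summable fun u => v (u + e) * t u) (h2 : Summable fun u => v u * t u)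
    (h3 : Summable fun u => v u * t (u - e)) :
    (∑' u, (v (u + e) - v u) * t u) = ∑' u, v u * (t (u - e) - t u) := by
  have eL : (∑' u, (v (u + e) - v u) * t u) = (∑' u, v (u + e) * t u) - ∑' u, v u * t u := by
    rw [← h1.tsum_sub h2]
    exact tsum_congr fun u => by ring
  have eS : (∑' u, v (u + e) * t u) = ∑' u, v u * t (u - e) := by
    rw [← (Equiv.addRight e).tsum_eq (fun u => v u * t (u - e))]
    exact tsum_congr fun u => by simp
  have eR : (∑' u, v u * (t (u - e) - t u)) = (∑' u, v u * t (u - e)) - ∑' u, v u * t u := by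
    rw [← h3.tsum_sub h2]
    exact tsum_congr fun u => by ring
  rw [eL, eS, eR]

/-! ## §3 The door functional is an `ℓ¹` pairing, with the definition-free weight `u ↦ tadpole A (defKerZ … (Pi.single u 1) β)` -/

/-- [folklore] **`tadpole_defKerZ_eq_tsum_weight`** — for bounded `v`: `tadpole A (defKerZ … v β) = Σ'_u v u · ω_β(u)` with the weight SPELLED OUT,
`ω_β(u) = Σ_κ (t₁ κ (u − e_κ) − t₁ κ u) − κ₂·(t₂ u − t₃ u)` (`t₁` the gradient stencils' tadpoles, `t₂∕t₃` the cuts'). -/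
theorem tadpole_defKerZ_eq_tsum_weight (hδ : 0 < δ) (hA : Decays A CA (δ / 2)) (hmix : LocStencilFM L tabs.mixFF C δ) (hH : VertexFamily tabs.H L C_H δ)
    {v : Site (3 + 1) → ℝ} {V : ℝ} (hV : 0 ≤ V) (hv : ∀ u, |v u| ≤ V) (β : Site (3 + 1) × Fin (3 + 1)) :
    tadpole A (defKerZ L tabs κ₂ v β) = ∑' u : Site (3 + 1), v u *
      ((∑ κ : Fin (3 + 1),
          (tadpole A (fun (x w : Site (3 + 1)) (a b : Fib 3) =>
              Sum.elim (fun α : Fin (3 + 1) => Sum.elim (fun α' : Fin (3 + 1) => M2Z L tabs (u - unitVec κ, κ) β x w (Sum.inl α) (Sum.inl α')) (fun _ => (0 : ℝ)) b) (fun _ => (0 : ℝ)) a)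
            - tadpole A (fun (x w : Site (3 + 1)) (a b : Fib 3) =>
              Sum.elim (fun α : Fin (3 + 1) => Sum.elim (fun α' : Fin (3 + 1) => M2Z L tabs (u, κ) β x w (Sum.inl α) (Sum.inl α')) (fun _ => (0 : ℝ)) b) (fun _ => (0 : ℝ)) a)))
        - κ₂ * (tadpole A (fun (x w : Site (3 + 1)) (a b : Fib 3) => if u = x then
              Sum.elim (fun α : Fin (3 + 1) => Sum.elim (fun α' : Fin (3 + 1) => tabs.H β.2 β.1 x w (Sum.inl α) (Sum.inl α')) (fun _ => (0 : ℝ)) b) (fun _ => (0 : ℝ)) a else 0)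
          - tadpole A (fun (x w : Site (3 + 1)) (a b : Fib 3) => if u = w then
              Sum.elim (fun α : Fin (3 + 1) => Sum.elim (fun α' : Fin (3 + 1) => tabs.H β.2 β.1 x w (Sum.inl α) (Sum.inl α')) (fun _ => (0 : ℝ)) b) (fun _ => (0 : ℝ)) a else 0))) := by
  have hδ2 : 0 < δ / 2 := half_pos hδ
  obtain ⟨B₁, hB₁, ht₁⟩ := exists_abs_tadpole_gradStencil_le L tabs hδ hA hmix β
  obtain ⟨B₂, hB₂, ht₂₃⟩ := exists_abs_tadpole_cuts_le L tabs hδ hA hH β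
  -- names for the three weights
  set t₁ : Fin (3 + 1) → Site (3 + 1) → ℝ := fun κ u => tadpole A (fun (x w : Site (3 + 1)) (a b : Fib 3) =>
      Sum.elim (fun α : Fin (3 + 1) => Sum.elim (fun α' : Fin (3 + 1) => M2Z L tabs (u, κ) β x w (Sum.inl α) (Sum.inl α')) (fun _ => (0 : ℝ)) b) (fun _ => (0 : ℝ)) a) with ht₁def
  set t₂ : Site (3 + 1) → ℝ := fun u => tadpole A (fun (x w : Site (3 + 1)) (a b : Fib 3) => if u = x then
      Sum.elim (fun α : Fin (3 + 1) => Sum.elim (fun α' : Fin (3 + 1) => tabs.H β.2 β.1 x w (Sum.inl α) (Sum.inl α')) (fun _ => (0 : ℝ)) b) (fun _ => (0 : ℝ)) a else 0) with ht₂def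
  set t₃ : Site (3 + 1) → ℝ := fun u => tadpole A (fun (x w : Site (3 + 1)) (a b : Fib 3) => if u = w then
      Sum.elim (fun α : Fin (3 + 1) => Sum.elim (fun α' : Fin (3 + 1) => tabs.H β.2 β.1 x w (Sum.inl α) (Sum.inl α')) (fun _ => (0 : ℝ)) b) (fun _ => (0 : ℝ)) a else 0) with ht₃def
  set p₀ : Site (3 + 1) := ((L : ℕ) : ℤ) • β.1 with hp₀
  -- decay, in the `t` names
  have d₁ : ∀ κ u, |t₁ κ u| ≤ B₁ * Real.exp (-δ * l1 (u - p₀)) := fun κ u => ht₁ κ u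
  have d₁' : ∀ (κ : Fin (3 + 1)) (u : Site (3 + 1)), |t₁ κ (u - unitVec κ)| ≤ (B₁ * Real.exp (δ * l1 (unitVec κ : Site (3 + 1)))) * Real.exp (-δ * l1 (u - p₀)) := by
    intro κ u
    refine (d₁ κ (u - unitVec κ)).trans ?_
    rw [mul_assoc, ← Real.exp_add]
    refine mul_le_mul_of_nonneg_left (Real.exp_le_exp.mpr ?_) hB₁
    have t := ExpKernelCalculus.l1_sub_triangle u (u - unitVec κ) p₀
    have e : l1 (u - (u - unitVec κ)) = l1 (unitVec κ : Site (3 + 1)) := by rw [sub_sub_cancel]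
    nlinarith [hδ.le, l1_nonneg (u - p₀), l1_nonneg (u - unitVec κ - p₀)]
  have d₂ : ∀ u, |t₂ u| ≤ B₂ * Real.exp (-(δ / 2) * l1 (u - p₀)) := fun u => (ht₂₃ u).1
  have d₃ : ∀ u, |t₃ u| ≤ B₂ * Real.exp (-(δ / 2) * l1 (u - p₀)) := fun u => (ht₂₃ u).2
  -- summabilities
  have hvs : ∀ (κ : Fin (3 + 1)) (u : Site (3 + 1)), |v (u + unitVec κ)| ≤ V := fun κ u => hv _
  have s₁ : ∀ κ, Summable fun u => v u * t₁ κ u := fun κ => (summable_abs_mul_of_decay hδ (d₁ κ) hv).of_abs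
  have s₁e : ∀ κ, Summable fun u => v (u + unitVec κ) * t₁ κ u := fun κ => (summable_abs_mul_of_decay hδ (d₁ κ) (hvs κ)).of_abs
  have s₁s : ∀ κ, Summable fun u => v u * t₁ κ (u - unitVec κ) := fun κ => (summable_abs_mul_of_decay hδ (d₁' κ) hv).of_abs
  have s₂ : Summable fun u => v u * t₂ u := (summable_abs_mul_of_decay hδ2 d₂ hv).of_abs
  have s₃ : Summable fun u => v u * t₃ u := (summable_abs_mul_of_decay hδ2 d₃ hv).of_abs
  rw [tadpole_defKerZ_pieces L tabs κ₂ hδ hA hmix hH hV hv β]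
  show (∑ κ : Fin (3 + 1), ∑' u, (v (u + unitVec κ) - v u) * t₁ κ u) - κ₂ * ((∑' u, v u * t₂ u) - ∑' u, v u * t₃ u)
    = ∑' u, v u * ((∑ κ : Fin (3 + 1), (t₁ κ (u - unitVec κ) - t₁ κ u)) - κ₂ * (t₂ u - t₃ u))
  have eκ : ∀ κ : Fin (3 + 1), (∑' u, (v (u + unitVec κ) - v u) * t₁ κ u) = ∑' u, v u * (t₁ κ (u - unitVec κ) - t₁ κ u) :=
    fun κ => tsum_shiftDiff_mul (unitVec κ) (s₁e κ) (s₁ κ) (s₁s κ)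
  simp_rw [eκ]
  have sκ : ∀ κ : Fin (3 + 1), Summable fun u => v u * (t₁ κ (u - unitVec κ) - t₁ κ u) := by
    intro κ
    have h := (s₁s κ).sub (s₁ κ)
    refine h.congr fun u => by ring
  rw [← Summable.tsum_finsetSum (fun κ _ => sκ κ), ← s₂.tsum_sub s₃, ← tsum_mul_left,
    ← (summable_sum fun κ _ => sκ κ).tsum_sub ((s₂.sub s₃).mul_left κ₂)]
  refine tsum_congr fun u => ?_
  simp only [mul_sub, Finset.mul_sum]
  ring

/-- [folklore] **`tadpole_defKerZ_single`** — THE WEIGHT IS THE FUNCTIONAL ON THE DELTA FUNCTIONS: the spelled-out `ω_β(u)` equals `tadpole A (defKerZ … (Pi.single u 1) β)`. -/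
theorem tadpole_defKerZ_single (hδ : 0 < δ) (hA : Decays A CA (δ / 2)) (hmix : LocStencilFM L tabs.mixFF C δ) (hH : VertexFamily tabs.H L C_H δ)
    (β : Site (3 + 1) × Fin (3 + 1)) (u : Site (3 + 1)) :
    tadpole A (defKerZ L tabs κ₂ (Pi.single u (1 : ℝ)) β)
      = (∑ κ : Fin (3 + 1),
          (tadpole A (fun (x w : Site (3 + 1)) (a b : Fib 3) =>
              Sum.elim (fun α : Fin (3 + 1) => Sum.elim (fun α' : Fin (3 + 1) => M2Z L tabs (u - unitVec κ, κ) β x w (Sum.inl α) (Sum.inl α')) (fun _ => (0 : ℝ)) b) (fun _ => (0 : ℝ)) a)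
            - tadpole A (fun (x w : Site (3 + 1)) (a b : Fib 3) =>
              Sum.elim (fun α : Fin (3 + 1) => Sum.elim (fun α' : Fin (3 + 1) => M2Z L tabs (u, κ) β x w (Sum.inl α) (Sum.inl α')) (fun _ => (0 : ℝ)) b) (fun _ => (0 : ℝ)) a)))
        - κ₂ * (tadpole A (fun (x w : Site (3 + 1)) (a b : Fib 3) => if u = x then
              Sum.elim (fun α : Fin (3 + 1) => Sum.elim (fun α' : Fin (3 + 1) => tabs.H β.2 β.1 x w (Sum.inl α) (Sum.inl α')) (fun _ => (0 : ℝ)) b) (fun _ => (0 : ℝ)) a else 0)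
          - tadpole A (fun (x w : Site (3 + 1)) (a b : Fib 3) => if u = w then
              Sum.elim (fun α : Fin (3 + 1) => Sum.elim (fun α' : Fin (3 + 1) => tabs.H β.2 β.1 x w (Sum.inl α) (Sum.inl α')) (fun _ => (0 : ℝ)) b) (fun _ => (0 : ℝ)) a else 0)) := by
  have hb : ∀ u' : Site (3 + 1), |(Pi.single u (1 : ℝ) : Site (3 + 1) → ℝ) u'| ≤ 1 := by
    intro u'
    by_cases h : u' = u
    · subst h; simp
    · rw [Pi.single_eq_of_ne h]; simp
  rw [tadpole_defKerZ_eq_tsum_weight L tabs κ₂ hδ hA hmix hH zero_le_one hb β, tsum_eq_single u]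
  · rw [Pi.single_eq_same, one_mul]
  · intro u' hu'
    rw [Pi.single_eq_of_ne hu', zero_mul]

/-- [folklore] **`tadpole_defKerZ_eq_tsum_single` — THE DOOR FUNCTIONAL IS AN `ℓ¹` PAIRING** (definition-free weight): for `Decays A CA (δ/2)`, (Lmix) at rate `δ > 0`, (LH) at rate `δ`, and `|v| ≤ V`,
`tadpole A (defKerZ … v β) = Σ'_u tadpole A (defKerZ … (Pi.single u 1) β) · v u`. -/
theorem tadpole_defKerZ_eq_tsum_single (hδ : 0 < δ) (hA : Decays A CA (δ / 2)) (hmix : LocStencilFM L tabs.mixFF C δ) (hH : VertexFamily tabs.H L C_H δ)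
    {v : Site (3 + 1) → ℝ} {V : ℝ} (hV : 0 ≤ V) (hv : ∀ u, |v u| ≤ V) (β : Site (3 + 1) × Fin (3 + 1)) :
    tadpole A (defKerZ L tabs κ₂ v β) = ∑' u : Site (3 + 1), tadpole A (defKerZ L tabs κ₂ (Pi.single u (1 : ℝ)) β) * v u := by
  rw [tadpole_defKerZ_eq_tsum_weight L tabs κ₂ hδ hA hmix hH hV hv β]
  refine tsum_congr fun u => ?_
  rw [tadpole_defKerZ_single L tabs κ₂ hδ hA hmix hH β u, mul_comm]

/-- [folklore] **`summable_abs_tadpole_defKerZ_single` — THE WEIGHT IS `ℓ¹`**: `Σ_u |tadpole A (defKerZ … (Pi.single u 1) β)| < ∞` (every piece decays from the window). -/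
theorem summable_abs_tadpole_defKerZ_single (hδ : 0 < δ) (hA : Decays A CA (δ / 2)) (hmix : LocStencilFM L tabs.mixFF C δ) (hH : VertexFamily tabs.H L C_H δ)
    (β : Site (3 + 1) × Fin (3 + 1)) :
    Summable fun u : Site (3 + 1) => |tadpole A (defKerZ L tabs κ₂ (Pi.single u (1 : ℝ)) β)| := by
  have hδ2 : 0 < δ / 2 := half_pos hδ
  obtain ⟨B₁, hB₁, ht₁⟩ := exists_abs_tadpole_gradStencil_le L tabs hδ hA hmix β
  obtain ⟨B₂, hB₂, ht₂₃⟩ := exists_abs_tadpole_cuts_le L tabs hδ hA hH β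
  set p₀ : Site (3 + 1) := ((L : ℕ) : ℤ) • β.1 with hp₀
  have one : ∀ u : Site (3 + 1), |(fun _ : Site (3 + 1) => (1 : ℝ)) u| ≤ 1 := fun u => by simp
  -- each of the pieces of the spelled-out weight is absolutely summable (against the constant `1`)
  have g₁ : ∀ κ : Fin (3 + 1), Summable fun u : Site (3 + 1) => |tadpole A (fun (x w : Site (3 + 1)) (a b : Fib 3) =>
      Sum.elim (fun α : Fin (3 + 1) => Sum.elim (fun α' : Fin (3 + 1) => M2Z L tabs (u, κ) β x w (Sum.inl α) (Sum.inl α')) (fun _ => (0 : ℝ)) b) (fun _ => (0 : ℝ)) a)| := by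
    intro κ
    have h := summable_abs_mul_of_decay (v := fun _ => (1 : ℝ)) hδ (ht₁ κ) one
    simpa using h
  have g₁' : ∀ κ : Fin (3 + 1), Summable fun u : Site (3 + 1) => |tadpole A (fun (x w : Site (3 + 1)) (a b : Fib 3) =>
      Sum.elim (fun α : Fin (3 + 1) => Sum.elim (fun α' : Fin (3 + 1) => M2Z L tabs (u - unitVec κ, κ) β x w (Sum.inl α) (Sum.inl α')) (fun _ => (0 : ℝ)) b) (fun _ => (0 : ℝ)) a)| :=
    fun κ => (Equiv.subRight (unitVec κ : Site (3 + 1))).summable_iff.mpr (g₁ κ)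
  have g₂ : Summable fun u : Site (3 + 1) => |tadpole A (fun (x w : Site (3 + 1)) (a b : Fib 3) => if u = x then
      Sum.elim (fun α : Fin (3 + 1) => Sum.elim (fun α' : Fin (3 + 1) => tabs.H β.2 β.1 x w (Sum.inl α) (Sum.inl α')) (fun _ => (0 : ℝ)) b) (fun _ => (0 : ℝ)) a else 0)| := by
    have h := summable_abs_mul_of_decay (v := fun _ => (1 : ℝ)) hδ2 (fun u => (ht₂₃ u).1) one
    simpa using h
  have g₃ : Summable fun u : Site (3 + 1) => |tadpole A (fun (x w : Site (3 + 1)) (a b : Fib 3) => if u = w then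
      Sum.elim (fun α : Fin (3 + 1) => Sum.elim (fun α' : Fin (3 + 1) => tabs.H β.2 β.1 x w (Sum.inl α) (Sum.inl α')) (fun _ => (0 : ℝ)) b) (fun _ => (0 : ℝ)) a else 0)| := by
    have h := summable_abs_mul_of_decay (v := fun _ => (1 : ℝ)) hδ2 (fun u => (ht₂₃ u).2) one
    simpa using h
  have e : ∀ u, tadpole A (defKerZ L tabs κ₂ (Pi.single u (1 : ℝ)) β) = _ := fun u => tadpole_defKerZ_single L tabs κ₂ hδ hA hmix hH β u
  simp_rw [e]
  refine Summable.abs ?_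
  refine Summable.sub (summable_sum fun κ _ => ((g₁' κ).of_abs).sub ((g₁ κ).of_abs)) (((g₂.of_abs).sub (g₃.of_abs)).mul_left κ₂)

end Summit.QuantumFields.BalabanUV.Beta.FP.TowerDoorDefectPairing

end
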